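import Mathlib
import Summits.ResolutionOfSingularities.ResolutionOfSingularities.Theses.SyzygyFlattening
import Summits.ResolutionOfSingularities.ResolutionOfSingularities.Theorems.SyzygyFlatteningDefs
import Summits.ResolutionOfSingularities.ResolutionOfSingularities.Theorems.SyzygyFlatteningRankOneTerminationSyzygyIndexPos
import Summits.ResolutionOfSingularities.ResolutionOfSingularities.Theorems.SyzygyFlatteningRankOneTerminationReduction
import Summits.ResolutionOfSingularities.ResolutionOfSingularities.Theorems.SyzygyFlatteningRankOneTerminationSurfaceCase
import Literature.AlgebraicGeometry.Resolution.LipmanValuativeQuadraticSequence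
import HarnessLib

/-!
# `RankOneTermination` is, modulo Lipman 1978, exactly its slice of transcendence degree `≥ 3`
# (crux stmt-ResolutionOfSingularities-17044, line `birth`, continuation lead c1)

Route `ResolutionOfSingularities/SyzygyFlattening`, crux #2 `RankOneTermination`: along every rank-one,
dimension-zero valuation ring `O ⊇ A ⊇ k` of `K = Frac A` (`A` finitely generated, `char k = p`) the
syzygy-flattening tower `T₀ = locAt O A`, `T_{m+1} = locAt O (nrm (chart O T_m))` reaches a regular
local ring (`TowerTerminates O A`; vocabulary of `Theorems/SyzygyFlatteningDefs.lean`,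
`rankOneTermination_iff` is `Iff.rfl`).

What the line `birth` has established, assembled here into single kernel-checked statements:

* `towerTerminates_of_three_le_of_rankOneTermination` — trivially, the crux implies its `n ≥ 3` slice
  (`n = syzygyIndex k K = tr.deg_k K`);
* `rankOneTermination_of_lipman_of_three_le` — conversely, GIVEN the valuative corollary of Lipman's
  theorem (the Literature named fact `Lipman1978ValuativeQuadraticSequence`, taken as a hypothesis: this
  theorem is CONDITIONAL on it), the `n ≥ 3` slice implies the whole crux: `n ≥ 1` by
  `stub_syzygyIndex_pos` (rank one excludes `O = K`), `n = 1` is the unconditional curve case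
  `towerTerminates_of_syzygyIndex_le_one` (landed, `…Reduction.lean`), `n = 2` is the surface case
  `stub_surfaceCase` (landed, `…SurfaceCase.lean`: by `…SurfaceStep.lean` the tower of a surface from `T₁`
  on IS the sequence of normalised quadratic transforms along the valuation, which the fact terminates);
* `stub_higherDimSlice` (registered glue stub of the line) / `rankOneTermination_iff_three_le_of_lipman`
  — hence, modulo Lipman 1978, the crux is EQUIVALENT to its `n ≥ 3` slice;
* `rankOneTermination_iff_higherStubs_of_lipman` — and equivalent to the conjunction of the two
  registered open stubs of the line (`stub_isoHigher`: eventual isolation for `n ≥ 3`;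
  `stub_isolatedTerminatesHigher`: eventually isolated towers terminate for `n ≥ 3`), i.e. the
  registered stubs are jointly neither weaker nor stronger than what is open.

So the open content of the crux is precisely: for `tr.deg_k K ≥ 3`, termination of the process
{isolated singular stage ↦ normalised point blow-up (lead-0 theorem, Cruxes/RankOneTermination/NOTES.md
§1); non-isolated stage ↦ normalised blow-up of the ideal of maximal minors of `Ωⁿ(O_Sing)`} along
rank-one dimension-zero valuations — no published result either way (presearch in the lead notes).
-/

noncomputable section

-- single-problem summit: the doubled namespace component `ResolutionOfSingularities` is forced
set_option linter.dupNamespace false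

namespace Summit.ResolutionOfSingularities.ResolutionOfSingularities.Theorems.SyzygyFlattening

open Summit.ResolutionOfSingularities.ResolutionOfSingularities.Theses.SyzygyFlattening
  (RankOneTermination)

/-- **The crux implies its `n ≥ 3` slice** (trivial specialisation; recorded so that the slice is
literally a weakening of the route decl). [folklore] -/
theorem towerTerminates_of_three_le_of_rankOneTermination (hR : RankOneTermination) :
    ∀ (p : ℕ), p.Prime → ∀ (k K : Type) [Field k] [CharP k p] [Field K] [Algebra k K]
      (O : ValuationSubring K) (A : Subalgebra k K), (∀ c : k, algebraMap k K c ∈ O) → A.FG →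
      IsFractionRing ↥A K → A.toSubring ≤ O.toSubring → DimZero k O → ringKrullDim ↥O = 1 →
      3 ≤ syzygyIndex k K → TowerTerminates O A :=
  fun p hp k K _ _ _ _ O A hk hFG hFrac hAO hdim0 hrk _ =>
    (rankOneTermination_iff.mp hR) p hp k K O A hk hFG hFrac hAO hdim0 hrk

/-- **Modulo Lipman 1978 the `n ≥ 3` slice gives the whole crux** (CONDITIONAL on the Literature
named fact `Lipman1978ValuativeQuadraticSequence`, hypothesis `hL`): `n ≥ 1` (`stub_syzygyIndex_pos`),
`n = 1` the landed curve case, `n = 2` the landed surface case `stub_surfaceCase hL`, `n ≥ 3` the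
hypothesis. [cite: Lipman1978, Theorem p. 151; Liu2002, Thm. 8.3.44] -/
theorem rankOneTermination_of_lipman_of_three_le
    (hL : Literature.AlgebraicGeometry.Resolution.Lipman1978ValuativeQuadraticSequence.{0})
    (h3 : ∀ (p : ℕ), p.Prime → ∀ (k K : Type) [Field k] [CharP k p] [Field K] [Algebra k K]
      (O : ValuationSubring K) (A : Subalgebra k K), (∀ c : k, algebraMap k K c ∈ O) → A.FG →
      IsFractionRing ↥A K → A.toSubring ≤ O.toSubring → DimZero k O → ringKrullDim ↥O = 1 →
      3 ≤ syzygyIndex k K → TowerTerminates O A) :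
    RankOneTermination := by
  refine rankOneTermination_iff.mpr fun p hp => ?_
  intro k K _ _ _ _ O A hk hFG hFrac hAO hdim0 hrk
  have hn1 : 1 ≤ syzygyIndex k K := stub_syzygyIndex_pos k K O A hk hFG hFrac hAO hrk
  by_cases h1 : syzygyIndex k K = 1
  · exact towerTerminates_of_syzygyIndex_le_one O A hk hFG hFrac hAO h1.le
  by_cases h2 : syzygyIndex k K = 2
  · exact stub_surfaceCase hL k K O A hk hFG hFrac hAO h2
  · exact h3 p hp k K O A hk hFG hFrac hAO hdim0 hrk (by omega)

/-- **Registered glue stub `stub_higherDimSlice` (crux stmt-ResolutionOfSingularities-17044, line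
`birth`) — modulo Lipman 1978, `RankOneTermination` is EQUIVALENT to its slice of transcendence
degree `≥ 3`** (CONDITIONAL: the Literature named fact `Lipman1978ValuativeQuadraticSequence` is the
antecedent): the curve case is unconditional and the surface case is Lipman's theorem in valuative
form, so exactly the `n ≥ 3` slice is open. [cite: Lipman1978, Theorem p. 151; Liu2002, Thm. 8.3.44] -/
theorem stub_higherDimSlice :
    Literature.AlgebraicGeometry.Resolution.Lipman1978ValuativeQuadraticSequence.{0} →
      (RankOneTermination ↔
        ∀ (p : ℕ), p.Prime → ∀ (k K : Type) [Field k] [CharP k p] [Field K] [Algebra k K]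
          (O : ValuationSubring K) (A : Subalgebra k K), (∀ c : k, algebraMap k K c ∈ O) → A.FG →
          IsFractionRing ↥A K → A.toSubring ≤ O.toSubring → DimZero k O → ringKrullDim ↥O = 1 →
          3 ≤ syzygyIndex k K → TowerTerminates O A) :=
  fun hL =>
    ⟨towerTerminates_of_three_le_of_rankOneTermination, rankOneTermination_of_lipman_of_three_le hL⟩

/-- **Modulo Lipman 1978, `RankOneTermination` is EQUIVALENT to its slice of transcendence degree
`≥ 3`** (hypothesis form of `stub_higherDimSlice`, CONDITIONAL on
`Lipman1978ValuativeQuadraticSequence`). [cite: Lipman1978, Theorem p. 151; Liu2002, Thm. 8.3.44] -/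
theorem rankOneTermination_iff_three_le_of_lipman
    (hL : Literature.AlgebraicGeometry.Resolution.Lipman1978ValuativeQuadraticSequence.{0}) :
    RankOneTermination ↔
      ∀ (p : ℕ), p.Prime → ∀ (k K : Type) [Field k] [CharP k p] [Field K] [Algebra k K]
        (O : ValuationSubring K) (A : Subalgebra k K), (∀ c : k, algebraMap k K c ∈ O) → A.FG →
        IsFractionRing ↥A K → A.toSubring ≤ O.toSubring → DimZero k O → ringKrullDim ↥O = 1 →
        3 ≤ syzygyIndex k K → TowerTerminates O A :=
  stub_higherDimSlice hL

/-- **Modulo Lipman 1978, `RankOneTermination` is EQUIVALENT to the conjunction of the two registered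
open stubs of line `birth`** (`stub_isoHigher`: for `n ≥ 3` the tower is eventually isolated — every
non-maximal prime of a late stage has regular localisation; `stub_isolatedTerminatesHigher`: for
`n ≥ 3` an eventually isolated tower terminates), CONDITIONAL on `Lipman1978ValuativeQuadraticSequence`.
(`→`) a terminating tower is eventually isolated (`eventually_isolated_of_towerTerminates`) and
terminates; (`←`) the two stubs compose to the `n ≥ 3` slice. So the registered stubs are jointly
exactly the open content. [cite: Lipman1978, Theorem p. 151] -/
theorem rankOneTermination_iff_higherStubs_of_lipman
    (hL : Literature.AlgebraicGeometry.Resolution.Lipman1978ValuativeQuadraticSequence.{0}) :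
    RankOneTermination ↔
      ((∀ (p : ℕ), p.Prime → ∀ (k K : Type) [Field k] [CharP k p] [Field K] [Algebra k K]
          (O : ValuationSubring K) (A : Subalgebra k K), (∀ c : k, algebraMap k K c ∈ O) → A.FG →
          IsFractionRing ↥A K → A.toSubring ≤ O.toSubring → DimZero k O → ringKrullDim ↥O = 1 →
          3 ≤ syzygyIndex k K →
          ∃ m₀ : ℕ, ∀ m : ℕ, m₀ ≤ m → ∀ 𝔭 : PrimeSpectrum ↥(tower O A m), ¬ 𝔭.asIdeal.IsMaximal →
            IsRegularLocalRing (Localization.AtPrime 𝔭.asIdeal)) ∧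
        (∀ (p : ℕ), p.Prime → ∀ (k K : Type) [Field k] [CharP k p] [Field K] [Algebra k K]
          (O : ValuationSubring K) (A : Subalgebra k K), (∀ c : k, algebraMap k K c ∈ O) → A.FG →
          IsFractionRing ↥A K → A.toSubring ≤ O.toSubring → DimZero k O → ringKrullDim ↥O = 1 →
          3 ≤ syzygyIndex k K →
          ∀ m₀ : ℕ, (∀ m : ℕ, m₀ ≤ m → ∀ 𝔭 : PrimeSpectrum ↥(tower O A m),
            ¬ 𝔭.asIdeal.IsMaximal → IsRegularLocalRing (Localization.AtPrime 𝔭.asIdeal)) →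
          TowerTerminates O A)) := by
  rw [rankOneTermination_iff_three_le_of_lipman hL]
  constructor
  · intro h3
    refine ⟨?_, ?_⟩
    · intro p hp k K _ _ _ _ O A hk hFG hFrac hAO hdim0 hrk hn3
      exact eventually_isolated_of_towerTerminates O A hk hFrac hAO
        (h3 p hp k K O A hk hFG hFrac hAO hdim0 hrk hn3)
    · intro p hp k K _ _ _ _ O A hk hFG hFrac hAO hdim0 hrk hn3 _ _
      exact h3 p hp k K O A hk hFG hFrac hAO hdim0 hrk hn3
  · rintro ⟨hI, hT⟩ p hp k K _ _ _ _ O A hk hFG hFrac hAO hdim0 hrk hn3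
    obtain ⟨m₀, hm₀⟩ := hI p hp k K O A hk hFG hFrac hAO hdim0 hrk hn3
    exact hT p hp k K O A hk hFG hFrac hAO hdim0 hrk hn3 m₀ hm₀

end Summit.ResolutionOfSingularities.ResolutionOfSingularities.Theorems.SyzygyFlattening

end
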